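import Summits.BirchSwinnertonDyer.BirchSwinnertonDyer.Theorems.GenusKolyvaginAtTwoGenusPrimitiveSupplyAtTwoDoorSupplyNegDisc
import Summits.BirchSwinnertonDyer.BirchSwinnertonDyer.Theorems.GenusKolyvaginAtTwoGenusPrimitiveSupplyAtTwoArchimedeanRowsHold
import Summits.BirchSwinnertonDyer.BirchSwinnertonDyer.Theorems.GenusKolyvaginAtTwoGenusPrimitiveSupplyAtTwoPrimeHeegnerTwinSilentPrimes
import Summits.BirchSwinnertonDyer.BirchSwinnertonDyer.Theorems.GenusKolyvaginAtTwoGenusPrimitiveSupplyAtTwoLoweringWalk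
import HarnessLib

/-!
# Route `GenusKolyvaginAtTwo`, crux #2 `GenusPrimitiveSupplyAtTwo` (stmt-BirchSwinnertonDyer-22136):
# THE DOOR SUPPLY AT `Δ > 0` FOR EVERY ODD `2`-SELMER DIMENSION — one silent (admissible) prime to flip the sign and the parity,
# then Mazur–Rubin's identity-prime lowering walk (`Ш(W)[2] ≠ 0` allowed)

Width seat `bsd-line-gk2-p4` g15 (cell `bsd-f1-sign2`), the `Δ > 0` companion of `…DoorSupplyNegDisc` (p680217). THEOREMS ONLY (no definition,
no named fact, no `sorry`); helper `--supports stmt-BirchSwinnertonDyer-22136`; no item is closed; BSD is not proved by any of this.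

WHY. `RankOneAtTwoOneDoor.DoorSupplyAtTwo` (the fkl line's AN-27 supply, «THEOREM on paper: MR Prop. 3.3 / Lemma 3.5 iterated») wants, for `W`
with `E(ℚ)[2] = 0`, an imaginary quadratic `K` with `d_K` door-admissible and `Sel₂(W^{(d_K)}) = 0`. On `{Δ > 0}` the lineage had it only on
the slice `Ш(W)[2] = 0` (`…DoorSupplySlice`: the egg door at `ε = +1`, two transposition primes at `ε = −1`). For `#Sel₂(W) = 2^k` with `k`
odd and ARBITRARY (so `Ш(W)[2] ≠ 0` allowed) two tree theorems suffice, with no analysis of the place `∞` beyond what they already contain: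

(1) THEOREM A (`F1Sign2.AdmissibleTwistSelmerShiftAtTwo`, kernel: `GenusKolyArch.admissibleTwistSelmerShiftAtTwo_holds`, gk2-p4 g12):
    for `Δ_W > 0`, `E(ℚ)[2] = 0` and a descent-admissible `d₁ < 0` (all its primes silent = `3`-cycle primes), `#Sel₂(W^{(d₁)})` is
    `#Sel₂(W)/2` or `2·#Sel₂(W)` — in either case `2^{2j}`, an EVEN power, when `k` is odd; silent admissible primes `ℓ ≡ 7 (mod 8)`,
    `ℓ ≡ −1 (mod p ∣ N)` exist (`GenusKolyTwin.exists_silent_prime_heegnerField`, gk2-p5).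
(2) Mazur–Rubin's Thm. 1.5 walk over `ℚ` (kernel: `GenusKolyLowering.exists_squarefree_twist_card_selmerGroup_eq_of_duality`, lead g8, from
    Prop. 5.2 = Lemma 3.6 + Čebotarev, modulo {Poitou–Tate at the real place, Tate's local Euler characteristic} — both tree theorems:
    `poitouTate_selmerStructure_duality_real_holds`, `GenusKolyLowering.localEP`): `#Sel₂(V) = 2^{2j}`, `#V(ℚ)[2] = 1`, `m ≠ 0` ⟹ a square-free
    `u ≡ 1 (mod m)`, `u > 0`, with `#Sel₂(V^{(u)}) = 1`.
Then `d = −ℓ·u` with `m = 8·N_W·ℓ`: `d < 0`, square-free, `d ≡ 1 (mod 8)`, every prime of `d` good (`ℓ` silent; the primes of `u` are prime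
to `N_W`), `(d/p) = (−ℓ/p)(u/p) = 1` at odd bad `p` — so `d` is door-admissible, `(d, N_W) = 1`, Heegner — and `W^{(d)} = (W^{(−ℓ)})^{(u)}` has
`Sel₂ = 0`:

* §52 `exists_doorAdmissible_twistSelmerTwoCard_eq_one_of_posDisc` — `W` globally minimal, `Δ_W > 0`, `Δ_W ∉ ℚ²`, `E(ℚ)[2] = 0`,
  `#Sel₂(W) = 2^k`, `k` odd ⟹ ∃ imaginary quadratic `K`, `d_K` door-admissible, `#Sel₂(W^{(d_K)}) = 1`, `(d_K, N_W) = 1`, Heegner;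
* §53 `exists_doorAdmissible_twistSelmerTwoCard_eq_one_of_not_isSquare` — both signs of `Δ` (with `…DoorSupplyNegDisc` at `Δ < 0`).

With `…DoorSupplyNegDiscSha` (`#Sel₂(W) = 2^{2r+1}` for rank one, `E(ℚ)[2] = 0`, `Ш(W)[2^∞]` finite) this gives `DoorSupplyAtTwo` on the whole
big-image habitat `{Δ ∉ ℚ², rank 1, Ш[2^∞] finite}` — see that file's capstone. What is NOT covered: square `Δ` (the `C₃`-image locus, where the
silent-prime supply of the tree is not stated) and an infinite `Ш(W)[2^∞]` (then `dim Sel₂(W)` may be even and no Heegner twist is `Sel₂`-trivial).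

References: Mazur–Rubin, Invent. Math. 181 (2010), Lemma 3.6, Prop. 5.2, Thm. 1.5 (arXiv:0904.3709 p. 12); Kramer, Trans. AMS 264 (1981), Prop. 3 and
Prop. 6; Monsky, Math. Z. 221 (1996), Thm. 1.5; Serre, *Abelian ℓ-adic representations*, I §2.2; Milne, *ADT*, I Thm. 4.10.
-/

set_option linter.dupNamespace false -- tree convention: `Summit.BirchSwinnertonDyer.BirchSwinnertonDyer.Theorems` (summit = sub-problem)
set_option autoImplicit false

noncomputable section

open scoped Classical

namespace Summit.BirchSwinnertonDyer.BirchSwinnertonDyer.Theorems.GenusKolyTransp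

open WeierstrassCurve Field NumberField IsDedekindDomain Function
open Literature.NumberTheory.EllipticCurves Literature.NumberTheory.GaloisRepresentations Literature.NumberTheory
open Literature.NumberTheory.QuadraticFields (Quadratic.exists_numberField_discr_eq Quadratic.isTotallyComplex_of_discr_neg
  Quadratic.ncard_primesOver_eq_two_iff_jacobiSym Quadratic.ncard_primesOver_two_eq_two_iff)
open Summit.BirchSwinnertonDyer.Rank1Residual.F1Sign2
open Summit.BirchSwinnertonDyer.Rank1Residual.F1Sign2.EggDoubling (eq_zero_of_two_smul_eq_zero)
open Summit.BirchSwinnertonDyer.BirchSwinnertonDyer.Theorems.RankOneAtTwoOneDoor (DoorAdmissible)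
open Summit.BirchSwinnertonDyer.BirchSwinnertonDyer.Theorems.GenusKolyTwin (exists_silent_prime_heegnerField)
open Summit.BirchSwinnertonDyer.BirchSwinnertonDyer.Theorems.GenusKolyArch (admissibleTwistSelmerShiftAtTwo_holds)
open Summit.BirchSwinnertonDyer.BirchSwinnertonDyer.Theorems.GenusKolyLowering (exists_squarefree_twist_card_selmerGroup_eq_of_duality
  natCard_torsionBy_two_eq_one_iff natCard_torsionBy_two_quadraticTwist_eq_one localEP)
open Summit.BirchSwinnertonDyer.BirchSwinnertonDyer.Theorems.SchneiderFreeAdditiveX3.PoitouTateReduction (poitouTate_selmerStructure_duality_real_holds)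

/-! ## §52 The door at `Δ > 0` for every odd `2`-Selmer dimension -/

/-- **THE DOOR SUPPLY AT `Δ > 0` FOR EVERY ODD `2`-SELMER DIMENSION.** `W/ℚ` globally minimal elliptic, `Δ_W > 0`, `Δ_W ∉ ℚ²`, `E(ℚ)[2] = 0`
(so `ρ̄_{W,2}` is onto), `#Sel₂(W) = 2^k` with `k` odd (`Ш(W)[2] ≠ 0` allowed): there is an imaginary quadratic `K` with `d_K` door-admissible
(`d_K = −ℓ·u`: one silent prime `ℓ ≡ 7 (mod 8)` and a square-free product `u ≡ 1 (mod 8 N_W ℓ)` of Mazur–Rubin lowering primes), `#Sel₂(W^{(d_K)}) = 1`,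
`(d_K, N_W) = 1` and the Heegner hypothesis for `N_W` — THEOREM A (`admissibleTwistSelmerShiftAtTwo_holds`) flips sign and parity, the Thm. 1.5 walk
(`exists_squarefree_twist_card_selmerGroup_eq_of_duality`) removes the even rest. [cite: MazurRubin2010, Lemma 3.6, Prop. 5.2, Thm. 1.5]
[cite: Kramer1981, Prop. 3 and Prop. 6] [cite: Monsky1996, Thm. 1.5] -/
theorem exists_doorAdmissible_twistSelmerTwoCard_eq_one_of_posDisc (W : WeierstrassCurve ℚ) [W.IsElliptic] [W.IsGloballyMinimal]
    [NeZero (W.conductorNorm ℤ)] (hΔ : 0 < W.Δ) (hnsq : ¬ IsSquare W.Δ) (hT : NoRationalTwoTorsion W) {k : ℕ}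
    (hk : Nat.card (W.selmerGroup 2) = 2 ^ k) (hodd : Odd k) :
    ∃ (K : Type) (_ : Field K) (_ : NumberField K),
      IsImaginaryQuadratic K ∧ DoorAdmissible W (NumberField.discr K) ∧ twistSelmerTwoCard W (NumberField.discr K) = 1 ∧
      Nat.Coprime (NumberField.discr K).natAbs (W.conductorNorm ℤ) ∧ SatisfiesHeegnerHypothesis (W.conductorNorm ℤ) K := by
  have hN : W.conductorNorm ℤ ≠ 0 := (W.conductorNorm_pos_holds).ne'
  -- `ρ̄_{W,2}` onto
  have hsurj : W.HasSurjectiveModNGaloisRep 2 := by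
    refine (hasSurjectiveModNGaloisRep_two_iff W).mpr ⟨fun P hP ↦ ?_, hnsq⟩
    have h := eq_zero_of_two_smul_eq_zero W hT P
    convert h (by convert hP)
  -- Step 1: a silent admissible prime `ℓ`; THEOREM A makes `#Sel₂(W^{(−ℓ)})` an even power of `2`
  obtain ⟨ℓ, -, hℓ, -, -, -, hdesc, -, -⟩ := exists_silent_prime_heegnerField W hΔ hsurj 0
  have hℓgood : ∀ _h : Fact ℓ.Prime, W.HasGoodReductionAtPrime ℓ := (hdesc.2.2.2.1 ℓ hℓ ⟨-1, by ring⟩).1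
  have hℓN : ¬ ℓ ∣ W.conductorNorm ℤ := fun h ↦ by
    haveI := Fact.mk hℓ
    exact (W.dvd_conductorNorm_iff_not_hasGoodReductionAtPrime ℓ).mp h (hℓgood inferInstance)
  obtain ⟨j, hj⟩ : ∃ j : ℕ, twistSelmerTwoCard W (-(ℓ : ℤ)) = 2 ^ (0 + 2 * j) := by
    obtain ⟨i, rfl⟩ := hodd
    have hA := admissibleTwistSelmerShiftAtTwo_holds W hΔ hT (-(ℓ : ℤ)) hdesc
    unfold selmerTwoCard at hA
    rw [hk] at hA
    rcases hA with h | h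
    · refine ⟨i, Nat.eq_of_mul_eq_mul_left zero_lt_two ?_⟩
      rw [h, zero_add, pow_succ, mul_comm]
    · exact ⟨i + 1, by rw [h]; ring⟩
  -- Step 2: the Mazur–Rubin walk on `V = W^{(−ℓ)}` with modulus `8 N_W ℓ`
  have hℓ0 : (((-(ℓ : ℤ) : ℤ)) : ℚ) ≠ 0 := by
    push_cast
    exact neg_ne_zero.mpr (by exact_mod_cast hℓ.ne_zero)
  haveI := W.isElliptic_quadraticTwist hℓ0
  have htorsW : Nat.card (AddSubgroup.torsionBy W.toAffine.Point ((2 : ℕ) : ℤ)) = 1 := by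
    refine natCard_torsionBy_two_eq_one_iff.mpr fun P hP ↦ ?_
    have h := eq_zero_of_two_smul_eq_zero W hT P
    convert h (by convert hP)
  have htorsV := natCard_torsionBy_two_quadraticTwist_eq_one W hℓ0 htorsW
  have hSelV : Nat.card ((W.quadraticTwist (((-(ℓ : ℤ) : ℤ)) : ℚ)).selmerGroup 2) = 2 ^ (0 + 2 * j) := hj
  have hm : 8 * W.conductorNorm ℤ * ℓ ≠ 0 := mul_ne_zero (mul_ne_zero (by norm_num) hN) hℓ.ne_zero
  obtain ⟨u, hu, hum, hSelu⟩ := exists_squarefree_twist_card_selmerGroup_eq_of_duality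
    (poitouTate_selmerStructure_duality_real_holds (K := ℚ)) (localEP ℚ) (W.quadraticTwist (((-(ℓ : ℤ) : ℤ)) : ℚ)) htorsV hSelV hm
  -- bookkeeping on `u`
  have hu0 : u ≠ 0 := fun h ↦ by rw [h] at hu; exact not_squarefree_zero hu
  have humod : ∀ n : ℤ, n ∣ ((8 * W.conductorNorm ℤ * ℓ : ℕ) : ℤ) → (u : ℤ) % n = 1 % n := fun n hn ↦ Int.ModEq.of_dvd hn hum
  have hu_ndvd : ∀ q : ℕ, q.Prime → q ∣ u → ¬ q ∣ 8 * W.conductorNorm ℤ * ℓ := fun q hq hqu hqm ↦ by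
    have h1 : (u : ℤ) % q = 1 % q := humod q (by exact_mod_cast hqm)
    have hq1 : (q : ℤ) ∣ 1 := by
      have hdu : (q : ℤ) ∣ (u : ℤ) := by exact_mod_cast hqu
      have := Int.emod_emod_of_dvd (u : ℤ) (dvd_refl (q : ℤ))
      have h2 : (q : ℤ) ∣ (u : ℤ) - 1 := Int.ModEq.dvd (Int.ModEq.symm h1)
      simpa using (Int.dvd_sub hdu h2)
    exact hq.one_lt.ne' (by exact_mod_cast Int.eq_one_of_dvd_one (by positivity) hq1)
  -- the door `d = −ℓ·u`
  obtain ⟨d, hd⟩ : ∃ d : ℤ, d = -(ℓ : ℤ) * u := ⟨_, rfl⟩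
  have hdneg : d < 0 := by
    rw [hd]
    exact mul_neg_of_neg_of_pos (neg_neg_of_pos (by exact_mod_cast hℓ.pos)) (by exact_mod_cast Nat.pos_of_ne_zero hu0)
  have hdabs : d.natAbs = ℓ * u := by rw [hd, Int.natAbs_mul, Int.natAbs_neg, Int.natAbs_natCast, Int.natAbs_natCast]
  have hℓu : ¬ ℓ ∣ u := fun h ↦ hu_ndvd ℓ hℓ h (Dvd.intro_left _ rfl)
  have hsf : Squarefree d := by
    rw [← Int.squarefree_natAbs, hdabs, Nat.squarefree_mul ((Nat.Prime.coprime_iff_not_dvd hℓ).mpr hℓu)]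
    exact ⟨hℓ.squarefree, hu⟩
  have hd8 : d % 8 = 1 := by
    have h1 : (-(ℓ : ℤ)) % 8 = 1 := hdesc.2.2.1
    have h2 : (u : ℤ) % 8 = 1 % 8 := humod 8 ⟨W.conductorNorm ℤ * ℓ, by push_cast; ring⟩
    rw [hd, Int.mul_emod, h1, h2]; norm_num
  have hjacN : ∀ p : ℕ, p.Prime → p ≠ 2 → p ∣ W.conductorNorm ℤ → jacobiSym d p = 1 := fun p hp hp2 hpN ↦ by
    haveI := Fact.mk hp
    have h1 : jacobiSym (-(ℓ : ℤ)) p = 1 :=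
      hdesc.2.2.2.2 p hp hp2 fun _ ↦ (W.dvd_conductorNorm_iff_not_hasGoodReductionAtPrime p).mp hpN
    have h2 : jacobiSym (u : ℤ) p = 1 := by
      rw [jacobiSym.mod_left, humod p (by exact_mod_cast Dvd.dvd.mul_right (Dvd.dvd.mul_left hpN 8) ℓ), ← jacobiSym.mod_left]
      exact jacobiSym.one_left p
    rw [hd, jacobiSym.mul_left, h1, h2, mul_one]
  have hprimes : ∀ q : ℕ, q.Prime → (q : ℤ) ∣ d → ¬ q ∣ W.conductorNorm ℤ := fun q hq hqd hqN ↦ by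
    have hq' : q ∣ ℓ * u := hdabs ▸ Int.natCast_dvd.mp hqd
    rcases (Nat.Prime.dvd_mul hq).mp hq' with h | h
    · exact hℓN (((Nat.prime_dvd_prime_iff_eq hq hℓ).mp h) ▸ hqN)
    · exact hu_ndvd q hq h (Dvd.dvd.mul_right (Dvd.dvd.mul_left hqN 8) ℓ)
  -- the field `K = ℚ(√d)`
  have hD : (d % 4 = 1 ∧ Squarefree d ∧ d ≠ 1) ∨ (4 ∣ d ∧ (d / 4 % 4 = 2 ∨ d / 4 % 4 = 3) ∧ Squarefree (d / 4)) :=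
    Or.inl ⟨by omega, hsf, by omega⟩
  obtain ⟨K, _, _, h2K, hdisc⟩ := Quadratic.exists_numberField_discr_eq hD
  have hK : IsImaginaryQuadratic K := ⟨h2K, Quadratic.isTotallyComplex_of_discr_neg h2K (by rw [hdisc]; exact hdneg)⟩
  have hH : SatisfiesHeegnerHypothesis (W.conductorNorm ℤ) K := by
    intro p hp hpN
    by_cases hp2 : p = 2
    · subst hp2
      have h := (Quadratic.ncard_primesOver_two_eq_two_iff h2K).mpr (by rw [hdisc]; exact hd8)
      exact_mod_cast h
    · exact (Quadratic.ncard_primesOver_eq_two_iff_jacobiSym h2K hp hp2).mpr (by rw [hdisc]; exact hjacN p hp hp2 hpN)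
  have hcop : Nat.Coprime (NumberField.discr K).natAbs (W.conductorNorm ℤ) := by
    rw [hdisc]
    exact Nat.coprime_of_dvd fun q hq hqd hqN ↦ hprimes q hq (Int.natCast_dvd.mpr hqd) hqN
  have hadm : DoorAdmissible W d := by
    refine ⟨hdneg, hsf, hd8, fun q hq hqd _ ↦ ?_, fun p hp hp2 hbad ↦ ?_⟩
    · by_contra hng
      exact hprimes q hq hqd ((W.dvd_conductorNorm_iff_not_hasGoodReductionAtPrime q).mpr hng)
    · haveI := Fact.mk hp
      exact hjacN p hp hp2 ((W.dvd_conductorNorm_iff_not_hasGoodReductionAtPrime p).mpr (hbad inferInstance))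
  have hcard : twistSelmerTwoCard W d = 1 := by
    have hu0' : (u : ℚ) ≠ 0 := by exact_mod_cast hu0
    haveI := (W.quadraticTwist (((-(ℓ : ℤ) : ℤ)) : ℚ)).isElliptic_quadraticTwist hu0'
    haveI := W.isElliptic_quadraticTwist (d := ((d : ℤ) : ℚ)) (by exact_mod_cast hdneg.ne)
    have hcast : ((d : ℤ) : ℚ) = (((-(ℓ : ℤ) : ℤ)) : ℚ) * (u : ℚ) := by rw [hd]; push_cast; ring
    have hcurve : W.quadraticTwist ((d : ℤ) : ℚ) = (W.quadraticTwist (((-(ℓ : ℤ) : ℤ)) : ℚ)).quadraticTwist (u : ℚ) := by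
      rw [quadraticTwist_quadraticTwist, hcast]
    rw [pow_zero] at hSelu
    -- transport `#Sel₂` along the equality of curves (the instance arguments are propositions)
    have key : ∀ (X Y : WeierstrassCurve ℚ) [X.IsElliptic] [Y.IsElliptic], X = Y →
        Nat.card (X.selmerGroup 2) = Nat.card (Y.selmerGroup 2) := by
      rintro X Y _ _ rfl
      rfl
    unfold twistSelmerTwoCard
    exact (key _ _ hcurve).trans hSelu
  refine ⟨K, inferInstance, inferInstance, hK, ?_, ?_, hcop, hH⟩
  · rw [hdisc]; exact hadm
  · rw [hdisc]; exact hcard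

/-! ## §53 Both signs of `Δ` -/

/-- **THE DOOR SUPPLY FOR EVERY ODD `2`-SELMER DIMENSION, BOTH SIGNS OF `Δ`.** `W/ℚ` globally minimal elliptic, `Δ_W ∉ ℚ²`, `E(ℚ)[2] = 0`,
`#Sel₂(W) = 2^k` with `k` odd: an imaginary quadratic `K`, `d_K` door-admissible, `#Sel₂(W^{(d_K)}) = 1`, `(d_K, N_W) = 1`, Heegner — §52 at `Δ > 0`,
`…DoorSupplyNegDisc.exists_doorAdmissible_twistSelmerTwoCard_eq_one_of_negDisc` at `Δ < 0`. [cite: MazurRubin2010, Prop. 3.3, Cor. 3.4 (i),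
Lemma 3.6, Prop. 5.2, Thm. 1.5] [cite: Kramer1981, Prop. 3 and Prop. 6] -/
theorem exists_doorAdmissible_twistSelmerTwoCard_eq_one_of_not_isSquare (W : WeierstrassCurve ℚ) [W.IsElliptic] [W.IsGloballyMinimal]
    [NeZero (W.conductorNorm ℤ)] (hnsq : ¬ IsSquare W.Δ) (hT : NoRationalTwoTorsion W) {k : ℕ}
    (hk : Nat.card (W.selmerGroup 2) = 2 ^ k) (hodd : Odd k) :
    ∃ (K : Type) (_ : Field K) (_ : NumberField K),
      IsImaginaryQuadratic K ∧ DoorAdmissible W (NumberField.discr K) ∧ twistSelmerTwoCard W (NumberField.discr K) = 1 ∧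
      Nat.Coprime (NumberField.discr K).natAbs (W.conductorNorm ℤ) ∧ SatisfiesHeegnerHypothesis (W.conductorNorm ℤ) K := by
  rcases lt_trichotomy W.Δ 0 with hΔ | hΔ | hΔ
  · exact exists_doorAdmissible_twistSelmerTwoCard_eq_one_of_negDisc W hΔ hT hk hodd
  · exact absurd hΔ W.isUnit_Δ.ne_zero
  · exact exists_doorAdmissible_twistSelmerTwoCard_eq_one_of_posDisc W hΔ hnsq hT hk hodd

end Summit.BirchSwinnertonDyer.BirchSwinnertonDyer.Theorems.GenusKolyTransp

end
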